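import Literature.MathematicalPhysics.QuantumFieldTheory.Balaban1983to89.Node00.Record12BgRowCoClassAtRecord
import Literature.MathematicalPhysics.QuantumFieldTheory.Balaban1983to89.Node00.CriticalOnFibre

/-!
# NODE 00 — ROW P11, CLASS EDITION, THE C′ RE-TYPE (LOCATED-M4 «FREE δ₀»): [15] Theorem 1 over print's class (6) with TWO-SIDED comparability of the
# per-scale thresholds — `VariationalThm1RegSepCo7` — and the row's suppliers re-keyed to it (generic minimiser, and def-R′'s `UbgMSCoOfRecord`)

Cell `pub-ymgap`, seat `pub-ymgap-node00-def-P11` g3 (R218 ∕ OPS-NOTE-16).  dag-lead g8 DEDUP-266 (9) (INBOX l.17998): «ONE declarer — the def-P11 successor on re-seat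
(natural pen: FILE 8∕9∕10 are its modules; C′ … NEW decl, the refutable ones left in place as located negatives, never edited)»; dag-n07-e g8 LOCATED-M4 (l.17944) + INTENT-C′
PROPOSAL (l.18065), adopted VERBATIM (clause, name, leaf, binder).  [15] = [Balaban1985Variational]; [6] = [Balaban1985RegularSpaces]; [III] = [Balaban1988Convergent];
[I] = [Balaban1987RG1].

LOCATED-M4 (dag-n07-e g8, recorded here; FILE 10 `Record12BgRowCoClass` stays byte-identical).  In `VariationalThm1RegSepCo6` (FILE 10 :295) — and in the superseded
(1.7)-class facts `VariationalThm1RegSepPrinted` (FILE 8) ∕ `…PrintedCo` (FILE 9) — the per-scale thresholds `δ` are comparable ONE WAY only (`δ n ≤ 2·δ (n+1)`, print's [III] (2.8)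
as typed), while the conclusion at level `n` is stated on `omegaPlaqs s.Ω n ⊇` every fine plaquette meeting `Ω_m`, `m ≥ n` (`omegaPlaqs s.Ω 0 = univ`).  So `δ 0` is free BELOW,
and on a `k = 1` datum whose printed level-0 plaquettes are trivial while a pinned coarse plaquette inside `Ω₁` is not, `δ 0 := min(δ 1, τ∕(2·C·B₃))` makes the `n = 0` conclusion
demand flatness inside `Ω₁` — `¬ VariationalThm1RegSepCo6 F N B₃ a₀ a₁` for every `B₃`, `0 < a₀`, `0 < a₁` (`N ≥ 2`; kernel certificate: dag-n07-e module 20c on dag-n21-c's §1).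
Print has ONE `ε₁` for all scales, so its level-`n` demand inside `Ω_{n+1}` (`B₃ε₁L^{−2n}`) is implied by the level-`(n+1)` demand (`B₃ε₁L^{−2(n+1)}`); the per-scale reading keeps
this nesting exactly when `δ (n+1) ≤ c·L²·δ n`.  REPAIR C′ (one clause; [III] (2.6)–(2.8) read BOTH ways — along a run in the β-window `ε_{m+1} ≤ (1 + O(1)g_m²)^{p₀}·ε_m`, K0a's
`Node00/Record13ReverseComparabilityOfBetaBox`): add `(∀ n, n < k → δ (n + 1) ≤ 2 * δ n)`; then `B₃·δ (n+1)·η_{n+1}² ≤ 2·B₃·δ n·L⁻²·η_n² ≤ B₃·δ n·η_n²` (`2 ≤ L²`), the deeper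
demand dominates inside `Ω_{n+1}`, and the witness misses C′ (it needs `δ₀ < τ∕(434L²B₃) ≤ δ₁∕2`).  CLASS: refuted-MISSTATED (per-scale split of a one-threshold sentence).

ADVERSARIAL SELF-CHECK of the C′ form (this seat, before typing; details on the cell bus INBOX l.18127).  (b) A gauge-mismatch interface datum (coarse data a pure gauge `k`,
`k(B) ≠ const` at the base points of `Ω₁`'s boundary blocks, fine field pinned to `1` on the crossing bonds, every (7) plaquette EXACTLY `1`) would refute C′ for every `B₃` under a
CORNER-anchored block convention; in the tree `Setup.emb` places the coarse site at the CENTRE of its block (B12 centred convention, `L` odd), an interior fine site, so a fine gauge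
with `g (emb y) = k(B)` and `g = 1` on the pinned layer exists, the fibre contains a flat configuration and every minimiser is flat — no contradiction.  (c) Members of `omegaPlaqs n` ∕
`Sect2.omegaBonds n` sticking out of `Ω_n`, and (1.9) on pinned level-0 ∕ crossing bonds, yield only FLOORS on `B₃` (≈ `2L²`, ≈ `4(d−1)`, ≈ `c·L³`) of the same class as the displayed
floor `2L² ≤ B₃` (ref-H READ-82, dag-n21-c p499903) — consumers display them; they are letters, not refutations.

CONTENTS.  §1 ★★ `VariationalThm1RegSepCo7` (def — FILE 10's `…Co6` text with the ONE extra binder; NEVER asserted), `.of_le`, `VariationalThm1RegSepCo6.toCo7` (the located-refutable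
sentence is the stronger one).  §2 suppliers GENERIC in the minimiser over (6): `plaqSmallOn_of_thm1RegSepCo7`, `coDivSmallOn_of_thm1RegSepCo7`, ★★★ `bgRowAtDatumU_of_thm1RegSepCo7C1`
(FILE 10 §4 verbatim, one extra binder `hcomp'` right after `hcomp`).  §3 at def-R′'s primed minimiser `UbgMSCoOfRecord … s 𝐖` (FILE 22 faces `isMinimizer_setOf_UbgMSCoOfRecord` ∕
`UbgMSCoOfRecord_eq_one_of_not_mem`): `plaqSmallOn_∕coDivSmallOn_UbgMSCoOfRecord_of_thm1RegSepCo7`, ★★★ `bgRowAtDatumCo_of_thm1RegSepCo7C1` — the v1.4 ∕ K0⁵ `bg` supplier under C′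
(FILE 10b verbatim, one extra binder).  §4 ★ `variationalThm1RegSepCo7_of_prop8` — the C′ fact FROM [15] PROPOSITION 8 + Fermat on the fibre (dag-n07-e g8 `Node00.CriticalOnFibre`:
`Prop8RegSepPrinted`, `regular_of_isMinimizer_class6_of_prop8`; n07-e's INTENT-C′ (A) term, by currying) — so the one named input left on this road can be taken one storey lower.

HONEST FRAMING.  Statement architecture + bookkeeping around ONE NAMED FACT (a `Prop` with print's constants as parameters, NEVER asserted; §4 derives it from n07-e's named
[15] Prop. 8, equally never asserted); nothing of Bałaban asserted or
discharged; K0⁗ NOT closed; counts unmoved (typed 28∕28 · discharged 5∕28); one finite `𝕋⁴` torus family at fixed `ε = L^{−K}`; not continuum ∕ OS ∕ mass gap ∕ Clay.  `SU(N)`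
model of record.  One `def` (the fact), no `instance`, no `sorry`.

DEPENDENCES (by name): FILE 10 `Node00.Record12BgRowCoClass` (`VariationalThm1RegSepCo6`, `bgRowAtDatumU_of_classBoundsC1`, `bgRowAtDatum_one`), FILE 10b
`Node00.Record12BgRowCoClassAtRecord` (import carrier), FILE 7c (`hletterI∕MS_of_numerics`), FILE 8 (`Sect2.DataSmall7P`), FILE 9 (`Sect2.CoDivClassOn`, `Sect2.CoDivSmallOn`,
`Sect2.omegaBonds`), node00-def-R FILE 22 `Node00.LargeFieldBackgroundCoOfRecord` (`UbgMSCoOfRecord`, `regMSCoOfRecord`, `isMinimizer_setOf_UbgMSCoOfRecord`,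
`UbgMSCoOfRecord_eq_one_of_not_mem`), dag-n07-e `Node00.CriticalOnFibre` (`Prop8RegSepPrinted`, `regular_of_isMinimizer_class6_of_prop8`), r11 `IsMinimizer`, `avOfRecord`,
`genSet`, def-R `omegaPlaqs`, `epsOfRecord`, `solvableDom`.
-/

noncomputable section

open MeasureTheory
open scoped Matrix.Norms.L2Operator

namespace Literature.MathematicalPhysics.QuantumFieldTheory.Balaban1983to89.Node00

open T4Continuum B14.Eq218Concrete B15DeterminingSets B12RegularSpaces111 B14RegularSpaces234 B14Radii T4AxialGaugeSmallField

/-! ## §1  [15] THEOREM 1 OVER PRINT'S CLASS (6), TWO-SIDED COMPARABILITY OF THE PER-SCALE THRESHOLDS (the C′ edition of the class-(6) named fact) -/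

section NamedFactCo7

variable (F : T4Family) (N : ℕ) [NeZero N]

/-- **★★ NAMED FACT, C′ EDITION — [15] THEOREM 1, (R)-READING, THE MINIMISER RANGING OVER PRINT'S CLASS (6) = [6] (1.7) ∧ (1.9) AT `ε₀`, THRESHOLDS COMPARABLE BOTH WAYS**
(director-ym №149 (3) class edition; dag-n07-e LOCATED-M4 repair C′; a `Prop` with parameters, NEVER asserted): for a separated `s`, thresholds `0 < δ_n ≤ a₁`, `B₃δ_n ≤ ε₀ ≤ a₀`,
comparable IN BOTH DIRECTIONS along the run (`δ_n ≤ 2δ_{n+1}` AND `δ_{n+1} ≤ 2δ_n` — [III] (2.6)–(2.8): in the β-window the one-step ratio `ε_{m+1}∕ε_m` lies in `[½, 2]`), a datum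
`𝐖` with print's (7) on the CONCORD range (`Sect2.DataSmall7P … δ W`), EVERY minimiser `U₀` of (2.12) on `𝔅({Ω_j}) = genSet s.Ω k` over the class
`U_k({Ω_j}, ε₀) = {U | (∀ n ≤ k, |U(∂p) − 1| < ε₀η_n² on omegaPlaqs s.Ω n) ∧ Sect2.CoDivClassOn s.Ω k ε₀ U}` lies in (8) = `U_k({Ω_j}, B₃δ)`: plaquettes `< B₃δ_n·η_n²` on
`omegaPlaqs s.Ω n` AND co-divergence `< B₃δ_n·η_n³` on `Sect2.omegaBonds s.Ω n`, every `n ≤ k`.  Print p.279: «there exists a minimal orbit in the space (8) U_k({Ω_j}, B₃ε₁) …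
This orbit is a unique critical orbit in the space (6) if B₃ε₁ ≤ ε₀ and ε₀ ≤ a₀».  With the second comparability clause `B₃δ_{n+1}η_{n+1}² ≤ B₃δ_nη_n²` (`2 ≤ L²`): the level-`(n+1)`
demand dominates the level-`n` demand inside `Ω_{n+1}`, as print's single `ε₁` does — this is FILE 10's `VariationalThm1RegSepCo6` with that ONE binder added (the un-primed sentence
leaves `δ 0` free below and is refutable for every `B₃`: LOCATED-M4, module docstring).  Inhabitation floor displayed by consumers: `2L² ≤ B₃` (members of `omegaPlaqs n` meeting
`Ω_n` from outside).
-- TODO(general form): ONE threshold ε₁ in print; general admissible `{Ω_j}`∕`𝔅_k` ([6] Sect. A) and print's separation letter `R ≥ R₁`; orbit uniqueness and (9)–(10) are not part of this sentence.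
[cite: Balaban1985Variational, Thm 1 (2),(6),(7)–(8) pp.278–279; Balaban1985RegularSpaces, (1.1)–(1.2) p.76, (1.7)–(1.9) p.77; Balaban1988Convergent, (2.6)–(2.8) pp.255–256, (2.12) p.256] -/
def VariationalThm1RegSepCo7 (B₃ a₀ a₁ : ℝ) : Prop :=
  ∀ (ν : Stage7Numerics) (M : ℕ) (g : ℕ → ℝ) (K k : ℕ) (s : SeqOfRecord F ν M g K k), Sect2.SeqSeparated ν.M₁ s → ∀ (ε₀ : ℝ) (δ : ℕ → ℝ),
    (∀ n, n ≤ k → 0 < δ n ∧ δ n ≤ a₁ ∧ B₃ * δ n ≤ ε₀) → (∀ n, n < k → δ n ≤ 2 * δ (n + 1)) → (∀ n, n < k → δ (n + 1) ≤ 2 * δ n) → ε₀ ≤ a₀ →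
    ∀ W : MSField (F.P K) (SU N), Sect2.DataSmall7P (avOfRecord F N K) s.Ω k δ W →
      ∀ U₀, IsMinimizer (avOfRecord F N K)
          {U | (∀ n, n ≤ k → PlaqSmallOn (omegaPlaqs s.Ω n) (ε₀ * (F.P K).eta n ^ 2) U) ∧ Sect2.CoDivClassOn s.Ω k ε₀ U} (genSet s.Ω k) W U₀ →
        (∀ n, n ≤ k → PlaqSmallOn (omegaPlaqs s.Ω n) (B₃ * δ n * (F.P K).eta n ^ 2) U₀) ∧
          ∀ n, n ≤ k → Sect2.CoDivSmallOn (Sect2.omegaBonds s.Ω n) (B₃ * δ n * (F.P K).eta n ^ 3) U₀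

variable {F N}

/-- The C′ class-(6) fact is ANTITONE in `a₀`, `a₁` (the letters enter only as ceilings; cf. FILE 10 `VariationalThm1RegSepCo6.of_le`). [cite: Balaban1985Variational, Thm 1 p.279 (the range «ε₀ ≤ a₀», «ε₁ ≤ a₁»)] -/
theorem VariationalThm1RegSepCo7.of_le {B₃ a₀ a₀' a₁ a₁' : ℝ} (h : VariationalThm1RegSepCo7 F N B₃ a₀ a₁) (ha₀ : a₀' ≤ a₀) (ha₁ : a₁' ≤ a₁) :
    VariationalThm1RegSepCo7 F N B₃ a₀' a₁' :=
  fun ν M g K k s hsep ε₀ δ hnum hcomp hcomp' hε W h7 U₀ hmin =>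
    h ν M g K k s hsep ε₀ δ (fun n hn => ⟨(hnum n hn).1, (hnum n hn).2.1.trans ha₁, (hnum n hn).2.2⟩) hcomp hcomp' (hε.trans ha₀) W h7 U₀ hmin

/-- **FILE 10's ONE-SIDED FACT IMPLIES THE C′ FACT** (drop the reverse comparability hypothesis): `VariationalThm1RegSepCo6` is the STRONGER sentence — and the located-refutable one
(LOCATED-M4, module docstring); every storey keyed on it re-keys to `…Co7` by threading one binder. [cite: Balaban1985Variational, Thm 1 (8) p.279 (bookkeeping); Balaban1988Convergent, (2.8) p.256] -/
theorem VariationalThm1RegSepCo6.toCo7 {B₃ a₀ a₁ : ℝ} (h : VariationalThm1RegSepCo6 F N B₃ a₀ a₁) : VariationalThm1RegSepCo7 F N B₃ a₀ a₁ :=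
  fun ν M g K k s hsep ε₀ δ hnum hcomp _ hε W h7 U₀ hmin => h ν M g K k s hsep ε₀ δ hnum hcomp hε W h7 U₀ hmin

end NamedFactCo7

/-! ## §2  Suppliers GENERIC IN THE MINIMISER over (6), keyed to the C′ fact (FILE 10 §4 with the one extra binder `hcomp'`) -/

section SuppliersCo7

variable {F : T4Family} {N : ℕ} [NeZero N]

/-- **★ EVERY MINIMISER OVER (6) AT THE RECORD'S LETTERS IS `B₃·cR·ε_n`-REGULAR (plaquettes)** for a separated sequence, thresholds comparable both ways, a datum with print's (7)
(`h7`), from the C′ class-(6) fact; `εreg` generic (`ν` is any numerics). [cite: Balaban1985Variational, Thm 1 (2),(6)–(8) pp.278–279; Balaban1988Convergent, (2.6)–(2.8) pp.255–256, (2.12) p.256] -/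
theorem plaqSmallOn_of_thm1RegSepCo7 {B₃ a₀ a₁ : ℝ} (h15 : VariationalThm1RegSepCo7 F N B₃ a₀ a₁) (ν : Stage7Numerics) (M : ℕ)
    (g : ℕ → ℝ) (K k : ℕ) (cR : ℝ) (s : SeqOfRecord F ν M g K k) (hsep : Sect2.SeqSeparated ν.M₁ s)
    (hnum : ∀ n, n ≤ k → 0 < cR * epsOfRecord ν g n ∧ cR * epsOfRecord ν g n ≤ a₁ ∧ B₃ * (cR * epsOfRecord ν g n) ≤ ν.εreg) (ha₀ : ν.εreg ≤ a₀)
    (hcomp : ∀ n, n < k → cR * epsOfRecord ν g n ≤ 2 * (cR * epsOfRecord ν g (n + 1)))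
    (hcomp' : ∀ n, n < k → cR * epsOfRecord ν g (n + 1) ≤ 2 * (cR * epsOfRecord ν g n))
    {W : MSField (F.P K) (SU N)} (h7 : Sect2.DataSmall7P (avOfRecord F N K) s.Ω k (fun n => cR * epsOfRecord ν g n) W)
    {U₀ : GaugeField (F.P K) 0 (SU N)} (hmin : IsMinimizer (avOfRecord F N K)
      {U | (∀ n, n ≤ k → PlaqSmallOn (omegaPlaqs s.Ω n) (ν.εreg * (F.P K).eta n ^ 2) U) ∧ Sect2.CoDivClassOn s.Ω k ν.εreg U} (genSet s.Ω k) W U₀) :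
    ∀ n, n ≤ k → PlaqSmallOn (omegaPlaqs s.Ω n) (B₃ * (cR * epsOfRecord ν g n) * (F.P K).eta n ^ 2) U₀ :=
  (h15 ν M g K k s hsep ν.εreg (fun n => cR * epsOfRecord ν g n) hnum hcomp hcomp' ha₀ W h7 U₀ hmin).1

/-- The co-divergence half ((8)'s second member) for every minimiser over (6), from the C′ fact. [cite: Balaban1985Variational, Thm 1 (8) p.279; Balaban1985RegularSpaces, (1.9) p.77] -/
theorem coDivSmallOn_of_thm1RegSepCo7 {B₃ a₀ a₁ : ℝ} (h15 : VariationalThm1RegSepCo7 F N B₃ a₀ a₁) (ν : Stage7Numerics) (M : ℕ)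
    (g : ℕ → ℝ) (K k : ℕ) (cR : ℝ) (s : SeqOfRecord F ν M g K k) (hsep : Sect2.SeqSeparated ν.M₁ s)
    (hnum : ∀ n, n ≤ k → 0 < cR * epsOfRecord ν g n ∧ cR * epsOfRecord ν g n ≤ a₁ ∧ B₃ * (cR * epsOfRecord ν g n) ≤ ν.εreg) (ha₀ : ν.εreg ≤ a₀)
    (hcomp : ∀ n, n < k → cR * epsOfRecord ν g n ≤ 2 * (cR * epsOfRecord ν g (n + 1)))
    (hcomp' : ∀ n, n < k → cR * epsOfRecord ν g (n + 1) ≤ 2 * (cR * epsOfRecord ν g n))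
    {W : MSField (F.P K) (SU N)} (h7 : Sect2.DataSmall7P (avOfRecord F N K) s.Ω k (fun n => cR * epsOfRecord ν g n) W)
    {U₀ : GaugeField (F.P K) 0 (SU N)} (hmin : IsMinimizer (avOfRecord F N K)
      {U | (∀ n, n ≤ k → PlaqSmallOn (omegaPlaqs s.Ω n) (ν.εreg * (F.P K).eta n ^ 2) U) ∧ Sect2.CoDivClassOn s.Ω k ν.εreg U} (genSet s.Ω k) W U₀) :
    ∀ n, n ≤ k → Sect2.CoDivSmallOn (Sect2.omegaBonds s.Ω n) (B₃ * (cR * epsOfRecord ν g n) * (F.P K).eta n ^ 3) U₀ :=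
  (h15 ν M g K k s hsep ν.εreg (fun n => cR * epsOfRecord ν g n) hnum hcomp hcomp' ha₀ W h7 U₀ hmin).2

/-- **★★★ ROW P11's BODY AT `(s, 𝐖)` FOR EVERY MINIMISER `U₀` OVER PRINT'S CLASS (6), FROM THE C′ FACT** — `VariationalThm1RegSepCo7` for the plaquette class bound, print's (7)
on the datum (`h7`, CONCORD range), the displayed C¹ class clause `B₃′·cR·ε_n·η_n³` for `U₀` ([15] Thm 1 (9)–(10), gauge-free reading), numerics incl. FILE 7c's two «C₀ large»
letters, (C1)(C2), no wrapping, `hcomp` AND `hcomp'`.  NO `h9`.  FILE 10's `bgRowAtDatumU_of_thm1RegSepCo6C1` with the one extra binder; def-R′ instantiates `U₀ := UbgMSCoOfRecord … s W`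
(§3). [cite: Balaban1985Variational, Thm 1 (2),(6)–(10) pp.278–279; Balaban1985RegularSpaces, (1.3)–(1.9) p.77; Balaban1988Convergent, (2.4)–(2.8) pp.255–256, (2.12) p.256, (2.27)–(2.28) p.259, (2.34)–(2.41) p.261; Balaban1987RG1, (1.11)–(1.16) p.262] -/
theorem bgRowAtDatumU_of_thm1RegSepCo7C1 {B₃ B₃' a₀ a₁ tI tMS : ℝ} (h15 : VariationalThm1RegSepCo7 F N B₃ a₀ a₁)
    (S : Sect2.Setting (MatA N) (SU N)) (hι : S.ι = ιSU N) (h𝓜 : S.𝓜 = B12RegularSpaces111SpecialUnitary.suModel N) (hS : S.Laws) (hpos : S.Pos)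
    (ν : Stage7Numerics) {M : ℕ} (hM : 0 < M) (K k : ℕ) (cR : ℝ) (hB₃ : 0 ≤ B₃) (hB₃' : 0 ≤ B₃')
    (hg : ∀ j, 1 ≤ j → j ≤ k → 0 < S.flow.g j ∧ S.flow.g j ^ 2 ≤ Real.exp (-1)) (hpq : ν.p₀ ≤ S.lf.q₀)
    (hnum : ∀ n, n ≤ k → 0 < cR * epsOfRecord ν S.flow.g n ∧ cR * epsOfRecord ν S.flow.g n ≤ a₁ ∧ B₃ * (cR * epsOfRecord ν S.flow.g n) ≤ ν.εreg)
    (ha₀ : ν.εreg ≤ a₀) (hcomp : ∀ n, n < k → cR * epsOfRecord ν S.flow.g n ≤ 2 * (cR * epsOfRecord ν S.flow.g (n + 1)))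
    (hcomp' : ∀ n, n < k → cR * epsOfRecord ν S.flow.g (n + 1) ≤ 2 * (cR * epsOfRecord ν S.flow.g n))
    (hα : ∀ n, 1 ≤ n → n ≤ k → 0 < S.lf.alpha0 (S.flow.g n) ∧ 0 < S.lf.alpha1 (S.flow.g n))
    (hBα : ∀ n, 1 ≤ n → n ≤ k → B₃ * (cR * epsOfRecord ν S.flow.g n) ≤ (1 - S.βc) * S.lf.alpha0 (S.flow.g n))
    (hΛI0 : 0 ≤ (4 * (B₃ + (((F.P K).d - 1 : ℕ) : ℝ) * (((F.P K).L : ℝ) * M) * B₃') + 16 * ((((F.P K).d - 1 : ℕ) : ℝ) * (((F.P K).L : ℝ) * M)) ^ 2 * B₃ ^ 2 * a₁) * cR * ν.A₀)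
    (hΛI : (4 * (B₃ + (((F.P K).d - 1 : ℕ) : ℝ) * (((F.P K).L : ℝ) * M) * B₃') + 16 * ((((F.P K).d - 1 : ℕ) : ℝ) * (((F.P K).L : ℝ) * M)) ^ 2 * B₃ ^ 2 * a₁) * cR * ν.A₀ ≤
      tI * S.lf.C₀) (htI : tI < S.cB)
    (hΛMS0 : 0 ≤ (4 * (B₃ + (((F.P K).d - 1 : ℕ) : ℝ) * (M : ℝ) * B₃') + 16 * ((((F.P K).d - 1 : ℕ) : ℝ) * (M : ℝ)) ^ 2 * B₃ ^ 2 * a₁) * cR * ν.A₀)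
    (hΛMS : (4 * (B₃ + (((F.P K).d - 1 : ℕ) : ℝ) * (M : ℝ) * B₃') + 16 * ((((F.P K).d - 1 : ℕ) : ℝ) * (M : ℝ)) ^ 2 * B₃ ^ 2 * a₁) * cR * ν.A₀ ≤ tMS * S.lf.C₀)
    (htMS : tMS < S.B * S.C * S.Mr)
    (hsN : ∀ n, 1 ≤ n → n ≤ k + 1 → ((B14.Eq213MaximalDomains.side (F.P K).L M n : ℕ) : ℤ) < (F.P K).sitesPerDir 0)
    (hcB : 2 * (((F.P K).d - 1 : ℕ) : ℝ) * ((F.P K).L * M) < S.cB) (hBCM : 2 * (((F.P K).d - 1 : ℕ) : ℝ) * M < S.B * S.C * S.Mr)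
    (hsmallI : ∀ j, 1 ≤ j → j ≤ k → (((F.P K).d - 1 : ℕ) : ℝ) * ((F.P K).L * M) * (F.P K).eta j * (B₃ * (cR * epsOfRecord ν S.flow.g j)) ≤ 1 / 2)
    (hsmallMS : ∀ n, 1 ≤ n → n ≤ k → (((F.P K).d - 1 : ℕ) : ℝ) * M * (F.P K).eta n * (B₃ * (cR * epsOfRecord ν S.flow.g n)) ≤ 1 / 2)
    (hC1 : ∀ j, 1 ≤ j → j ≤ k → ∃ t : ℕ, 0 < t ∧ RkOfRecord (F.P K).L ν.r (S.flow.g j) = (F.P K).L * t)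
    (hC2 : ∀ j, 1 ≤ j → j ≤ k → dCubeSide (F.P K).L M (RkOfRecord (F.P K).L ν.r (S.flow.g j)) j ∣ (F.P K).sitesPerDir 0)
    (s : SeqOfRecord F ν M S.flow.g K k) (hsep : Sect2.SeqSeparated ν.M₁ s) {W : MSField (F.P K) (SU N)}
    (h7 : Sect2.DataSmall7P (avOfRecord F N K) s.Ω k (fun n => cR * epsOfRecord ν S.flow.g n) W)
    {U₀ : GaugeField (F.P K) 0 (SU N)} (hmin : IsMinimizer (avOfRecord F N K)
      {U | (∀ n, n ≤ k → PlaqSmallOn (omegaPlaqs s.Ω n) (ν.εreg * (F.P K).eta n ^ 2) U) ∧ Sect2.CoDivClassOn s.Ω k ν.εreg U} (genSet s.Ω k) W U₀)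
    (hclassC1 : ∀ n, 1 ≤ n → n ≤ k → PlaqC1SmallOn (plaqInside (s.Ω n)) (B₃' * (cR * epsOfRecord ν S.flow.g n) * (F.P K).eta n ^ 3) U₀) :
    ∀ j, 1 ≤ j → j ≤ k → ∀ X : (Sect2.domSys (F.P K) M j).Dom,
      (Sect2.domSites (F.P K) M j X ⊆ s.Λ j →
        Sect2.ofBackgroundC S.ι (U₀) ∈
          Sect2.spaceI S (Sect2.Residual.unit (F.P K) (MatA N)) M j (Sect2.domSites (F.P K) M j X) (S.lf.alpha0 (S.flow.g j)) (S.lf.alpha1 (S.flow.g j))) ∧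
      (Sect2.admB (F.P K) ν M S.flow.g s.Ω s.Λ j (Sect2.domSites (F.P K) M j X) = true →
        Sect2.ofBackgroundC S.ι (U₀) ∈
          Sect2.spaceMS S (Sect2.Residual.unit (F.P K) (MatA N)) M j (Sect2.domSites (F.P K) M j X) s.Ω) :=
  bgRowAtDatumU_of_classBoundsC1 S hι h𝓜 hS hpos ν hM K k (fun n hn => mul_nonneg hB₃ (hnum n hn).1.le) (fun n hn => mul_nonneg hB₃' (hnum n hn).1.le) s U₀
    (plaqSmallOn_of_thm1RegSepCo7 h15 ν M S.flow.g K k cR s hsep hnum ha₀ hcomp hcomp' h7 hmin)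
    hclassC1 hα hBα hsN hcB hBCM hsmallI hsmallMS hC1 hC2
    (hletterI_of_numerics S.lf ν M hg hpq (fun j hj => ⟨(hnum j hj).1, (hnum j hj).2.1⟩) hΛI0 hΛI htI (fun j h1 hj => (hα j h1 hj).1))
    (hletterMS_of_numerics S.lf ν M hg hpq (fun n hn => ⟨(hnum n hn).1, (hnum n hn).2.1⟩) hΛMS0 hΛMS htMS (fun n h1 hn => (hα n h1 hn).1))

end SuppliersCo7

/-! ## §3  The C′ suppliers AT def-R′'s PRIMED MINIMISER `UbgMSCoOfRecord … s 𝐖` (FILE 10b with the one extra binder) — the v1.4 ∕ K0⁵ `bg` supplier under C′ -/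

section AtRecordCo7

variable {F : T4Family} {N : ℕ} [NeZero N]

/-- **★ def-R′'s BACKGROUND `UbgMSCoOfRecord … s 𝐖` IS `B₃·cR·ε_n`-REGULAR AT EVERY SCALE ON THE SOLVABLE SET** (plaquette half of (8)), from the C′ class-(6) fact, for a separated
sequence, thresholds comparable both ways and a datum with print's (7) (`h7`). [cite: Balaban1985Variational, Thm 1 (2),(6)–(8) pp.278–279; Balaban1988Convergent, (2.6)–(2.8) pp.255–256, (2.12) p.256] -/
theorem plaqSmallOn_UbgMSCoOfRecord_of_thm1RegSepCo7 {B₃ a₀ a₁ : ℝ} (h15 : VariationalThm1RegSepCo7 F N B₃ a₀ a₁) (ν : Stage7Numerics) (M : ℕ)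
    (g : ℕ → ℝ) (K k : ℕ) (cR : ℝ) (s : SeqOfRecord F ν M g K k) (hsep : Sect2.SeqSeparated ν.M₁ s)
    (hnum : ∀ n, n ≤ k → 0 < cR * epsOfRecord ν g n ∧ cR * epsOfRecord ν g n ≤ a₁ ∧ B₃ * (cR * epsOfRecord ν g n) ≤ ν.εreg) (ha₀ : ν.εreg ≤ a₀)
    (hcomp : ∀ n, n < k → cR * epsOfRecord ν g n ≤ 2 * (cR * epsOfRecord ν g (n + 1)))
    (hcomp' : ∀ n, n < k → cR * epsOfRecord ν g (n + 1) ≤ 2 * (cR * epsOfRecord ν g n))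
    {W : MSField (F.P K) (SU N)} (h7 : Sect2.DataSmall7P (avOfRecord F N K) s.Ω k (fun n => cR * epsOfRecord ν g n) W)
    (hsol : W ∈ solvableDom (avOfRecord F N K) (regMSCoOfRecord F N ν K k s.Ω) (genSet s.Ω k)) :
    ∀ n, n ≤ k → PlaqSmallOn (omegaPlaqs s.Ω n) (B₃ * (cR * epsOfRecord ν g n) * (F.P K).eta n ^ 2) (UbgMSCoOfRecord F N ν M g K k s W) :=
  plaqSmallOn_of_thm1RegSepCo7 h15 ν M g K k cR s hsep hnum ha₀ hcomp hcomp' h7 (isMinimizer_setOf_UbgMSCoOfRecord ν M g K k s hsol)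

/-- The co-divergence half of (8) at def-R′'s background on the solvable set, from the C′ fact. [cite: Balaban1985Variational, Thm 1 (8) p.279; Balaban1985RegularSpaces, (1.9) p.77] -/
theorem coDivSmallOn_UbgMSCoOfRecord_of_thm1RegSepCo7 {B₃ a₀ a₁ : ℝ} (h15 : VariationalThm1RegSepCo7 F N B₃ a₀ a₁) (ν : Stage7Numerics) (M : ℕ)
    (g : ℕ → ℝ) (K k : ℕ) (cR : ℝ) (s : SeqOfRecord F ν M g K k) (hsep : Sect2.SeqSeparated ν.M₁ s)
    (hnum : ∀ n, n ≤ k → 0 < cR * epsOfRecord ν g n ∧ cR * epsOfRecord ν g n ≤ a₁ ∧ B₃ * (cR * epsOfRecord ν g n) ≤ ν.εreg) (ha₀ : ν.εreg ≤ a₀)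
    (hcomp : ∀ n, n < k → cR * epsOfRecord ν g n ≤ 2 * (cR * epsOfRecord ν g (n + 1)))
    (hcomp' : ∀ n, n < k → cR * epsOfRecord ν g (n + 1) ≤ 2 * (cR * epsOfRecord ν g n))
    {W : MSField (F.P K) (SU N)} (h7 : Sect2.DataSmall7P (avOfRecord F N K) s.Ω k (fun n => cR * epsOfRecord ν g n) W)
    (hsol : W ∈ solvableDom (avOfRecord F N K) (regMSCoOfRecord F N ν K k s.Ω) (genSet s.Ω k)) :
    ∀ n, n ≤ k → Sect2.CoDivSmallOn (Sect2.omegaBonds s.Ω n) (B₃ * (cR * epsOfRecord ν g n) * (F.P K).eta n ^ 3) (UbgMSCoOfRecord F N ν M g K k s W) :=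
  coDivSmallOn_of_thm1RegSepCo7 h15 ν M g K k cR s hsep hnum ha₀ hcomp hcomp' h7 (isMinimizer_setOf_UbgMSCoOfRecord ν M g K k s hsol)

/-- **★★★ ROW P11's BODY AT `(s, 𝐖)` FOR def-R′'s PRIMED MINIMISER `UbgMSCoOfRecord … s 𝐖`, FROM THE C′ FACT** — the v1.4 ∕ K0⁵ `bg` row's supplier under C′: on the solvable
set §2's `bgRowAtDatumU_of_thm1RegSepCo7C1` at `isMinimizer_setOf_UbgMSCoOfRecord`, off it the junk `1` by FILE 10's `bgRowAtDatum_one`.  Hypotheses: the C′ class-(6) fact, print's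
(7) on the datum (`h7`), the displayed C¹ class clause for the primed minimiser on the solvable set ([15] Thm 1 (9)–(10), gauge-free reading), the numerics∕letters of FILE 10b's ★★★
theorem, `hcomp` AND `hcomp'` — and NO `h9`. [cite: Balaban1985Variational, Thm 1 (2),(6)–(10) pp.278–279; Balaban1988Convergent, (2.6)–(2.8) pp.255–256, (2.12) p.256, (2.27)–(2.28) p.259, (2.34)–(2.41) p.261; Balaban1987RG1, (1.11)–(1.16) p.262] -/
theorem bgRowAtDatumCo_of_thm1RegSepCo7C1 {B₃ B₃' a₀ a₁ tI tMS : ℝ} (h15 : VariationalThm1RegSepCo7 F N B₃ a₀ a₁)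
    (S : Sect2.Setting (MatA N) (SU N)) (hι : S.ι = ιSU N) (h𝓜 : S.𝓜 = B12RegularSpaces111SpecialUnitary.suModel N) (hS : S.Laws) (hpos : S.Pos)
    (ν : Stage7Numerics) {M : ℕ} (hM : 0 < M) (K k : ℕ) (cR : ℝ) (hB₃ : 0 ≤ B₃) (hB₃' : 0 ≤ B₃')
    (hg : ∀ j, 1 ≤ j → j ≤ k → 0 < S.flow.g j ∧ S.flow.g j ^ 2 ≤ Real.exp (-1)) (hpq : ν.p₀ ≤ S.lf.q₀)
    (hnum : ∀ n, n ≤ k → 0 < cR * epsOfRecord ν S.flow.g n ∧ cR * epsOfRecord ν S.flow.g n ≤ a₁ ∧ B₃ * (cR * epsOfRecord ν S.flow.g n) ≤ ν.εreg)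
    (ha₀ : ν.εreg ≤ a₀) (hcomp : ∀ n, n < k → cR * epsOfRecord ν S.flow.g n ≤ 2 * (cR * epsOfRecord ν S.flow.g (n + 1)))
    (hcomp' : ∀ n, n < k → cR * epsOfRecord ν S.flow.g (n + 1) ≤ 2 * (cR * epsOfRecord ν S.flow.g n))
    (hα : ∀ n, 1 ≤ n → n ≤ k → 0 < S.lf.alpha0 (S.flow.g n) ∧ 0 < S.lf.alpha1 (S.flow.g n))
    (hBα : ∀ n, 1 ≤ n → n ≤ k → B₃ * (cR * epsOfRecord ν S.flow.g n) ≤ (1 - S.βc) * S.lf.alpha0 (S.flow.g n))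
    (hΛI0 : 0 ≤ (4 * (B₃ + (((F.P K).d - 1 : ℕ) : ℝ) * (((F.P K).L : ℝ) * M) * B₃') + 16 * ((((F.P K).d - 1 : ℕ) : ℝ) * (((F.P K).L : ℝ) * M)) ^ 2 * B₃ ^ 2 * a₁) * cR * ν.A₀)
    (hΛI : (4 * (B₃ + (((F.P K).d - 1 : ℕ) : ℝ) * (((F.P K).L : ℝ) * M) * B₃') + 16 * ((((F.P K).d - 1 : ℕ) : ℝ) * (((F.P K).L : ℝ) * M)) ^ 2 * B₃ ^ 2 * a₁) * cR * ν.A₀ ≤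
      tI * S.lf.C₀) (htI : tI < S.cB)
    (hΛMS0 : 0 ≤ (4 * (B₃ + (((F.P K).d - 1 : ℕ) : ℝ) * (M : ℝ) * B₃') + 16 * ((((F.P K).d - 1 : ℕ) : ℝ) * (M : ℝ)) ^ 2 * B₃ ^ 2 * a₁) * cR * ν.A₀)
    (hΛMS : (4 * (B₃ + (((F.P K).d - 1 : ℕ) : ℝ) * (M : ℝ) * B₃') + 16 * ((((F.P K).d - 1 : ℕ) : ℝ) * (M : ℝ)) ^ 2 * B₃ ^ 2 * a₁) * cR * ν.A₀ ≤ tMS * S.lf.C₀)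
    (htMS : tMS < S.B * S.C * S.Mr)
    (hsN : ∀ n, 1 ≤ n → n ≤ k + 1 → ((B14.Eq213MaximalDomains.side (F.P K).L M n : ℕ) : ℤ) < (F.P K).sitesPerDir 0)
    (hcB : 2 * (((F.P K).d - 1 : ℕ) : ℝ) * ((F.P K).L * M) < S.cB) (hBCM : 2 * (((F.P K).d - 1 : ℕ) : ℝ) * M < S.B * S.C * S.Mr)
    (hsmallI : ∀ j, 1 ≤ j → j ≤ k → (((F.P K).d - 1 : ℕ) : ℝ) * ((F.P K).L * M) * (F.P K).eta j * (B₃ * (cR * epsOfRecord ν S.flow.g j)) ≤ 1 / 2)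
    (hsmallMS : ∀ n, 1 ≤ n → n ≤ k → (((F.P K).d - 1 : ℕ) : ℝ) * M * (F.P K).eta n * (B₃ * (cR * epsOfRecord ν S.flow.g n)) ≤ 1 / 2)
    (hC1 : ∀ j, 1 ≤ j → j ≤ k → ∃ t : ℕ, 0 < t ∧ RkOfRecord (F.P K).L ν.r (S.flow.g j) = (F.P K).L * t)
    (hC2 : ∀ j, 1 ≤ j → j ≤ k → dCubeSide (F.P K).L M (RkOfRecord (F.P K).L ν.r (S.flow.g j)) j ∣ (F.P K).sitesPerDir 0)
    (s : SeqOfRecord F ν M S.flow.g K k) (hsep : Sect2.SeqSeparated ν.M₁ s) (W : MSField (F.P K) (SU N))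
    (h7 : Sect2.DataSmall7P (avOfRecord F N K) s.Ω k (fun n => cR * epsOfRecord ν S.flow.g n) W)
    (hclassC1 : W ∈ solvableDom (avOfRecord F N K) (regMSCoOfRecord F N ν K k s.Ω) (genSet s.Ω k) →
      ∀ n, 1 ≤ n → n ≤ k → PlaqC1SmallOn (plaqInside (s.Ω n)) (B₃' * (cR * epsOfRecord ν S.flow.g n) * (F.P K).eta n ^ 3) (UbgMSCoOfRecord F N ν M S.flow.g K k s W)) :
    ∀ j, 1 ≤ j → j ≤ k → ∀ X : (Sect2.domSys (F.P K) M j).Dom,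
      (Sect2.domSites (F.P K) M j X ⊆ s.Λ j →
        Sect2.ofBackgroundC S.ι (UbgMSCoOfRecord F N ν M S.flow.g K k s W) ∈
          Sect2.spaceI S (Sect2.Residual.unit (F.P K) (MatA N)) M j (Sect2.domSites (F.P K) M j X) (S.lf.alpha0 (S.flow.g j)) (S.lf.alpha1 (S.flow.g j))) ∧
      (Sect2.admB (F.P K) ν M S.flow.g s.Ω s.Λ j (Sect2.domSites (F.P K) M j X) = true →
        Sect2.ofBackgroundC S.ι (UbgMSCoOfRecord F N ν M S.flow.g K k s W) ∈
          Sect2.spaceMS S (Sect2.Residual.unit (F.P K) (MatA N)) M j (Sect2.domSites (F.P K) M j X) s.Ω) := by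
  by_cases hsol : W ∈ solvableDom (avOfRecord F N K) (regMSCoOfRecord F N ν K k s.Ω) (genSet s.Ω k)
  · exact bgRowAtDatumU_of_thm1RegSepCo7C1 h15 S hι h𝓜 hS hpos ν hM K k cR hB₃ hB₃' hg hpq hnum ha₀ hcomp hcomp' hα hBα hΛI0 hΛI htI hΛMS0 hΛMS htMS
      hsN hcB hBCM hsmallI hsmallMS hC1 hC2 s hsep h7 (isMinimizer_setOf_UbgMSCoOfRecord ν M S.flow.g K k s hsol) (hclassC1 hsol)
  · rw [UbgMSCoOfRecord_eq_one_of_not_mem ν M S.flow.g K k s hsol]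
    exact bgRowAtDatum_one S hpos ν M K k s hα

end AtRecordCo7

/-! ## §4  The C′ fact FROM [15] PROPOSITION 8 (dag-n07-e g8 `Node00.CriticalOnFibre`): a minimiser over the open class (6) is critical on the fibre (Fermat), and Prop. 8 is the
regularity of critical configurations — n07-e's INTENT-C′ (A) bridge, by currying -/

section FromProp8

variable {F : T4Family} {N : ℕ} [NeZero N]

/-- **★ [15] THEOREM 1 (R) OVER CLASS (6), C′ EDITION, FROM [15] PROPOSITION 8** (both named facts, neither asserted): n07-e's `regular_of_isMinimizer_class6_of_prop8` — a minimiser of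
(2.12) over the open class (6) is a critical configuration on the fibre `𝔘(𝔅_k, V)` (`isCritOnFibre_of_isMinimizer_class6`, Fermat), and Prop. 8 p.304 bounds every (6)-regular critical
configuration with (7)-regular data by (8) — curried into the shape of `VariationalThm1RegSepCo7` (INTENT-C′ PROPOSAL (A), INBOX l.18065, term verbatim).
[cite: Balaban1985Variational, Thm 1 (6)–(8) pp.278–279, Prop. 8 p.304; Balaban1985RegularSpaces, (1.7)–(1.9) p.77; Balaban1988Convergent, (2.6)–(2.8) pp.255–256, (2.12) p.256] -/
theorem variationalThm1RegSepCo7_of_prop8 {B₃ a₀ a₁ : ℝ} (h8 : Prop8RegSepPrinted F N B₃ a₀ a₁) : VariationalThm1RegSepCo7 F N B₃ a₀ a₁ :=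
  fun ν M g K k s hsep ε₀ δ hδ hcomp hcomp' hε₀ W h7 _ hU₀ =>
    regular_of_isMinimizer_class6_of_prop8 h8 ν M g K k s hsep ε₀ δ hδ hcomp hcomp' hε₀ W h7 hU₀

end FromProp8

end Literature.MathematicalPhysics.QuantumFieldTheory.Balaban1983to89.Node00

end
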